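import Literature.AnabelianGeometry.AbsoluteAnabelian.MLFGaloisDehnTwistTransvections
import HarnessLib

/-!
# `DehnTwistTransvections ⟹ DehnTwistTransvectionsOnUnits` (the over-quantified fact implies the faithful one)

PROOF-ONLY companion (abc-iut cell, seat abc-iut-c312-1 gen 9) of the corrected named fact
`Literature.AnabelianGeometry.AbsoluteAnabelian.DehnTwistTransvectionsOnUnits` (K. Kondo arXiv:2512.09231 §2, unit-restricted
form — see the Correction note in `MLFGaloisDehnTwistTransvections.lean`): the predicate implication
`MLFClosure.liftActsOnUnitLogAs_of_liftActsOnLogAs` and `dehnTwistTransvectionsOnUnits_of_dehnTwistTransvections` (recorded only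
to relate the two declarations; the over-quantified `DehnTwistTransvections` is NOT to be consumed), plus the orientation
check `MLFClosure.liftActsOnUnitLogAs_refl_id` (the identity of `G_k` acts as the identity).  Classical; no side taken.
[cite: Kondo2025OuterAutMLF, §2 proof of Thm 2.3 p.10]
-/

noncomputable section

namespace Literature.AnabelianGeometry.AbsoluteAnabelian

open Literature.IUT.HodgeArakelov ValuativeRel
open scoped ValuativeRel

namespace MLFClosure

/-- The over-quantified predicate implies the unit-restricted one. [cite: Kondo2025OuterAutMLF, §2 proof of Thm 2.3 p.10] -/
theorem liftActsOnUnitLogAs_of_liftActsOnLogAs (C : MLFClosure.{0}) (p : ℕ) [Fact p.Prime] (hp : valuation C.k p < 1)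
    {φ : (ModelMLFGaloisData.galois C.k C.K).tmPair.Pi ≃ₜ* (ModelMLFGaloisData.galois C.k C.K).tmPair.Pi}
    {T : C.k → C.k} (h : C.LiftActsOnLogAs p hp φ T) : C.LiftActsOnUnitLogAs p hp φ T :=
  fun x x' u u' t t' _ hx hx' hl ht ht' => h x x' u u' t t' hx hx' hl ht ht'

/-- Orientation check: the identity of `G_k` acts on the unit logarithms as the identity.
[cite: Kondo2025OuterAutMLF, §2 proof of Thm 2.3 p.10] -/
theorem liftActsOnUnitLogAs_refl_id (C : MLFClosure.{0}) (p : ℕ) [Fact p.Prime] (hp : valuation C.k p < 1) :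
    C.LiftActsOnUnitLogAs p hp (ContinuousMulEquiv.refl _) id := by
  intro x x' u u' t t' _ hx hx' hlift ht ht'
  rw [AbsTopMonoids.Genuine.liftM_refl C (fun _ => rfl), MulEquiv.refl_apply] at hlift
  subst hlift
  have huu' : u = u' := (algebraMap C.k C.K).injective (hx.symm.trans hx')
  subst huu'
  exact ((algebraMap C.k C.K).injective (ht'.symm.trans ht)).symm ▸ rfl

end MLFClosure

/-- The over-quantified fact implies the faithful one. [cite: Kondo2025OuterAutMLF, §2 proof of Thm 2.3 p.10] -/
theorem dehnTwistTransvectionsOnUnits_of_dehnTwistTransvections (h : DehnTwistTransvections) :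
    DehnTwistTransvectionsOnUnits := by
  intro C p _ hp hp2 hd
  obtain ⟨n, y, a, b, hab, ⟨φ, hφ⟩, ⟨φ', hφ'⟩⟩ := h C p hp hp2 hd
  exact ⟨n, y, a, b, hab, ⟨φ, C.liftActsOnUnitLogAs_of_liftActsOnLogAs p hp hφ⟩,
    ⟨φ', C.liftActsOnUnitLogAs_of_liftActsOnLogAs p hp hφ'⟩⟩

end Literature.AnabelianGeometry.AbsoluteAnabelian

end
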